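import Summits.Ventures.Crystal3D.Theorems.StickyWulffConstantTextureLiminfTexShadowCoverageBarlowSteer2WideRepGlue
import HarnessLib

/-!
# TexShadow row (e) / EDGE-ON v8.10: the THREE RESIDUAL CLASSES of the represented two-sided ledger — `FluxPairFailAt`, `SepAt`, `ReadAt` — and the COVER LEMMA
# (lane T, crux `TextureLiminfV5`, stmt-Ventures-23912, sub-crux EDGE-ON; cf-p1 DECISION (clxxvii)(2) 2026-08-29T08:59:23Z; 19480-p1 g15 memo STEEP-PLATE-g15.md §4/§5b)

HONEST FRAMING. Venture `Summits/Ventures/Crystal3D` (cell `crystal3d-full`), route `route-Ventures-StickyWulffConstant`, helper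
`--supports` the law-v5 crux `TextureLiminfV5` (stmt-Ventures-23912), registered line `TexShadow` (v8.9 `stub_edgeOnRep` → v8.10 three-class split).
DEFINITIONS (regime predicates on `(σ₁, σ₂, L₁, L₂)`) + the cover lemma + cut glue; PROOFS are pure logic over the typed certificate plus the launch geometry
already in the tree; NO certificate is asserted; rung F-C1 not moved.

THE POINT.  After re-presentation (`…Steer2WideRepDefs/Glue`) no plate is steep, so every pair that the represented two-sided wide-steered menu leaves
uncertified LAUNCHES in some presentation pair and fails a PAIR clause (`launches_with_failing_pairClause_of_not_repCertified`).  This file names the three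
ways and proves they cover:
* `IsRep σ L τ F` — `(F, τ)` is one of the two presentations `(L, σ)`, `(twinRepFrame L, −σ)` of the plate;
* **`FluxPairFailAt c₀ σ₁ σ₂ L₁ L₂`** — in EVERY presentation pair, EVERY admissible launch pair `(z₁, v₁), (z₂, v₂)` (`SteerLaunchAt (1/3)`) has a bilayer pair
  on which the two steered step rises sum to `< √2·c₀` (the twin-aware flux-pair sliver `{b₁ + b₂ < √2·c₀}` of the memo §5b, stated launch-wise; it is never
  vacuous: `exists_isRep_launches`, and it forces BOTH plates weak: `weakPlateAt_of_fluxPairFailAt`, threshold `√2·c₀ − 1/4`);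
* **`SepAt c₀ …`** — some presentation pair has an admissible, flux-feasible launch pair two of whose chain frames are Barlow-coaxial (clause (iii)_z fails:
  the joint-prefix-read cells of the memo §4, Σ3ⁿ misorientations);
* **`ReadAt c₀ …`** — some presentation pair has an admissible, flux-feasible launch pair one of whose chain frames carries the other plate's bilayer lattice or
  its basal twin's (clause (i)/(ii) fails: the reads);
* **`edgeOnRep_cover : EdgeOnAt c₀ … → ¬ BarlowMenuSteer2WideRepCertified c₀ … → FluxPairFailAt c₀ … ∨ SepAt c₀ … ∨ ReadAt c₀ …`** (in fact without the
  `EdgeOnAt` hypothesis: `threeClasses_of_not_repCertified`) — the contrapositive of «a flux-feasible launch pair whose chains neither read nor are coaxial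
  certifies» (`twoSidedSteerWide_of_launches`);
* the cut glue **`edgeOnRep_of_threeClasses`**: cores on `EdgeOnAt (13/25) ∧ FluxPairFailAt (13/25)`, on `EdgeOnAt ∧ SepAt`, on `EdgeOnAt ∧ ReadAt` give the core on
  `EdgeOnAt (13/25) ∧ ¬ BarlowMenuSteer2WideRepCertified (13/25)` (= v8.9's `stub_edgeOnRep`), general `(c₀, R₀)` form `residualFaultedCoreOnAt_edgeOnRep_of_threeClasses`.
WHAT THIS IS NOT: no certificate and no size statement (sizes: 19480-p1's TWIN runs j328191/j328192); the combinatorial identification «SepAt = joint prefix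
reads of the relative twin chain» (memo §4) is NOT proved here; F-C1 not moved.
-/

noncomputable section

open scoped BigOperators InnerProductSpace ENNReal
open MeasureTheory Filter

namespace Summit.Ventures.Crystal3D.Cruxes.TextureLiminf.TexShadow

open Summit.Ventures.Crystal3D Summit.Ventures.Crystal3D.Theorems
open Literature.MathematicalPhysics.StatisticalMechanics (IsHaggSeq fccStacking barlowStacking basalMirror)

/-! ## Presentations of a plate -/

/-- **`(F, τ)` is a presentation of the plate `(L, σ)`**: the given one or the twin re-presentation `(twinRepFrame L, −σ)`. -/
def IsRep (σ : ℤ → ℤ) (L : E3 ≃ₗᵢ[ℝ] E3) (τ : ℤ → ℤ) (F : E3 ≃ₗᵢ[ℝ] E3) : Prop :=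
  (F = L ∧ τ = σ) ∨ (F = twinRepFrame L ∧ τ = fun n => -σ n)

/-- The given presentation. -/
theorem isRep_self (σ : ℤ → ℤ) (L : E3 ≃ₗᵢ[ℝ] E3) : IsRep σ L σ L :=
  Or.inl ⟨rfl, rfl⟩

/-- The twin re-presentation. -/
theorem isRep_twinRep (σ : ℤ → ℤ) (L : E3 ≃ₗᵢ[ℝ] E3) : IsRep σ L (fun n => -σ n) (twinRepFrame L) :=
  Or.inr ⟨rfl, rfl⟩

/-- A presentation presents the same plate with the same origin. -/
theorem stacking_of_isRep {σ τ : ℤ → ℤ} {L F : E3 ≃ₗᵢ[ℝ] E3} (h : IsRep σ L τ F) (s : E3) : stacking F s τ = stacking L s σ :=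
  stacking_of_rep_choice h s

/-- A presentation's word is a Hägg word. -/
theorem isHaggSeq_of_isRep {σ τ : ℤ → ℤ} {L F : E3 ≃ₗᵢ[ℝ] E3} (h : IsRep σ L τ F) (hσ : IsHaggSeq σ) : IsHaggSeq τ := by
  rcases h with ⟨-, rfl⟩ | ⟨-, rfl⟩
  · exact hσ
  · exact isHaggSeq_negWord hσ

/-- A menu certificate in ANY presentation pair is a represented-menu certificate. -/
theorem repCertified_of_isRep {c₀ : ℝ} {σ₁ σ₂ τ₁ τ₂ : ℤ → ℤ} {L₁ L₂ F₁ F₂ : E3 ≃ₗᵢ[ℝ] E3}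
    (h₁ : IsRep σ₁ L₁ τ₁ F₁) (h₂ : IsRep σ₂ L₂ τ₂ F₂) (hc : BarlowMenuSteer2WideCertified c₀ τ₁ τ₂ F₁ F₂) :
    BarlowMenuSteer2WideRepCertified c₀ σ₁ σ₂ L₁ L₂ := by
  rcases h₁ with ⟨rfl, rfl⟩ | ⟨rfl, rfl⟩ <;> rcases h₂ with ⟨rfl, rfl⟩ | ⟨rfl, rfl⟩
  · exact Or.inl hc
  · exact Or.inr (Or.inr (Or.inl hc))
  · exact Or.inr (Or.inl hc)
  · exact Or.inr (Or.inr (Or.inr hc))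

/-- Contrapositive: an uncertified pair is uncertified in every presentation pair. -/
theorem not_certified_of_isRep {c₀ : ℝ} {σ₁ σ₂ τ₁ τ₂ : ℤ → ℤ} {L₁ L₂ F₁ F₂ : E3 ≃ₗᵢ[ℝ] E3}
    (h : ¬ BarlowMenuSteer2WideRepCertified c₀ σ₁ σ₂ L₁ L₂) (h₁ : IsRep σ₁ L₁ τ₁ F₁) (h₂ : IsRep σ₂ L₂ τ₂ F₂) :
    ¬ BarlowMenuSteer2WideCertified c₀ τ₁ τ₂ F₁ F₂ :=
  fun hc => h (repCertified_of_isRep h₁ h₂ hc)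

/-- **Every pair launches in some presentation pair** (chord `1/3`): by `not_steepPlateAt_rep_third_e₃` / `_neg_e₃` each plate has a presentation that is not
steep toward the wall, and a non-steep plate launches (`exists_steerLaunchAt_iff_not_steepPlateAt_third(_neg)`). -/
theorem exists_isRep_launches (σ₁ σ₂ : ℤ → ℤ) (L₁ L₂ : E3 ≃ₗᵢ[ℝ] E3) :
    ∃ (τ₁ τ₂ : ℤ → ℤ) (F₁ F₂ : E3 ≃ₗᵢ[ℝ] E3), IsRep σ₁ L₁ τ₁ F₁ ∧ IsRep σ₂ L₂ τ₂ F₂ ∧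
      ∃ z₁ v₁ z₂ v₂ : E3, SteerLaunchAt (1 / 3) F₁ τ₁ e₃ z₁ v₁ ∧ SteerLaunchAt (1 / 3) F₂ τ₂ (-e₃) z₂ v₂ := by
  -- plate 1: a non-steep presentation toward `e₃`
  have h₁ : ∃ (τ₁ : ℤ → ℤ) (F₁ : E3 ≃ₗᵢ[ℝ] E3), IsRep σ₁ L₁ τ₁ F₁ ∧ ∃ z₁ v₁ : E3, SteerLaunchAt (1 / 3) F₁ τ₁ e₃ z₁ v₁ := by
    rcases not_steepPlateAt_rep_third_e₃ L₁ with hs | hs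
    · exact ⟨σ₁, L₁, isRep_self σ₁ L₁, (exists_steerLaunchAt_iff_not_steepPlateAt_third L₁ σ₁).2 hs⟩
    · exact ⟨_, _, isRep_twinRep σ₁ L₁, (exists_steerLaunchAt_iff_not_steepPlateAt_third _ _).2 hs⟩
  -- plate 2: a non-steep presentation toward `−e₃`
  have h₂ : ∃ (τ₂ : ℤ → ℤ) (F₂ : E3 ≃ₗᵢ[ℝ] E3), IsRep σ₂ L₂ τ₂ F₂ ∧ ∃ z₂ v₂ : E3, SteerLaunchAt (1 / 3) F₂ τ₂ (-e₃) z₂ v₂ := by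
    rcases not_steepPlateAt_rep_third_neg_e₃ L₂ with hs | hs
    · exact ⟨σ₂, L₂, isRep_self σ₂ L₂, (exists_steerLaunchAt_iff_not_steepPlateAt_third_neg L₂ σ₂).2 hs⟩
    · exact ⟨_, _, isRep_twinRep σ₂ L₂, (exists_steerLaunchAt_iff_not_steepPlateAt_third_neg _ _).2 hs⟩
  obtain ⟨τ₁, F₁, hr₁, z₁, v₁, hl₁⟩ := h₁
  obtain ⟨τ₂, F₂, hr₂, z₂, v₂, hl₂⟩ := h₂
  exact ⟨τ₁, τ₂, F₁, F₂, hr₁, hr₂, z₁, v₁, z₂, v₂, hl₁, hl₂⟩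

/-! ## The three residual classes -/

/-- **FLUX-PAIR FAILURE** (the twin-aware flux-pair sliver, launch-wise): in every presentation pair, every admissible launch pair at chord `1/3` has a
bilayer pair `(i, j)` on which the two steered step rises sum to `< √2·c₀` — no represented two-sided family pair can meet the flux clause. -/
def FluxPairFailAt (c₀ : ℝ) (σ₁ σ₂ : ℤ → ℤ) (L₁ L₂ : E3 ≃ₗᵢ[ℝ] E3) : Prop :=
  ∀ (τ₁ τ₂ : ℤ → ℤ) (F₁ F₂ : E3 ≃ₗᵢ[ℝ] E3), IsRep σ₁ L₁ τ₁ F₁ → IsRep σ₂ L₂ τ₂ F₂ →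
    ∀ z₁ v₁ z₂ v₂ : E3, SteerLaunchAt (1 / 3) F₁ τ₁ e₃ z₁ v₁ → SteerLaunchAt (1 / 3) F₂ τ₂ (-e₃) z₂ v₂ →
      ∃ i j : ℤ, steerRise (upFrame F₁ e₃) (upWord F₁ τ₁ e₃) e₃ z₁ v₁ i +
        steerRise (upFrame F₂ (-e₃)) (upWord F₂ τ₂ (-e₃)) (-e₃) z₂ v₂ j < Real.sqrt 2 * c₀

/-- **SEPARATION FAILURE** («sep», the joint-prefix-read cells): some presentation pair has an admissible launch pair at chord `1/3` meeting the flux clause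
two of whose chain frames are Barlow-coaxial (clause (iii)_z fails). -/
def SepAt (c₀ : ℝ) (σ₁ σ₂ : ℤ → ℤ) (L₁ L₂ : E3 ≃ₗᵢ[ℝ] E3) : Prop :=
  ∃ (τ₁ τ₂ : ℤ → ℤ) (F₁ F₂ : E3 ≃ₗᵢ[ℝ] E3), IsRep σ₁ L₁ τ₁ F₁ ∧ IsRep σ₂ L₂ τ₂ F₂ ∧
    ∃ z₁ v₁ z₂ v₂ : E3, SteerLaunchAt (1 / 3) F₁ τ₁ e₃ z₁ v₁ ∧ SteerLaunchAt (1 / 3) F₂ τ₂ (-e₃) z₂ v₂ ∧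
      (∀ i j : ℤ, Real.sqrt 2 * c₀ ≤ steerRise (upFrame F₁ e₃) (upWord F₁ τ₁ e₃) e₃ z₁ v₁ i +
        steerRise (upFrame F₂ (-e₃)) (upWord F₂ τ₂ (-e₃)) (-e₃) z₂ v₂ j) ∧
      ∃ G₁ ∈ chainFrames z₁ (upFrame F₁ e₃) v₁, ∃ G₂ ∈ chainFrames z₂ (upFrame F₂ (-e₃)) v₂, CoAxFrames G₁ G₂

/-- **READ FAILURE** («read»): some presentation pair has an admissible launch pair at chord `1/3` meeting the flux clause one of whose chain frames carries
the other plate's bilayer lattice or its basal twin's (clause (i) or (ii) fails). -/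
def ReadAt (c₀ : ℝ) (σ₁ σ₂ : ℤ → ℤ) (L₁ L₂ : E3 ≃ₗᵢ[ℝ] E3) : Prop :=
  ∃ (τ₁ τ₂ : ℤ → ℤ) (F₁ F₂ : E3 ≃ₗᵢ[ℝ] E3), IsRep σ₁ L₁ τ₁ F₁ ∧ IsRep σ₂ L₂ τ₂ F₂ ∧
    ∃ z₁ v₁ z₂ v₂ : E3, SteerLaunchAt (1 / 3) F₁ τ₁ e₃ z₁ v₁ ∧ SteerLaunchAt (1 / 3) F₂ τ₂ (-e₃) z₂ v₂ ∧
      (∀ i j : ℤ, Real.sqrt 2 * c₀ ≤ steerRise (upFrame F₁ e₃) (upWord F₁ τ₁ e₃) e₃ z₁ v₁ i +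
        steerRise (upFrame F₂ (-e₃)) (upWord F₂ τ₂ (-e₃)) (-e₃) z₂ v₂ j) ∧
      ((∃ G ∈ chainFrames z₁ (upFrame F₁ e₃) v₁,
          G '' fccStacking 1 (Real.sqrt (2 / 3)) = F₂ '' fccStacking 1 (Real.sqrt (2 / 3)) ∨
          G '' fccStacking 1 (Real.sqrt (2 / 3)) = (twinFrame F₂ (F₂ e₃)) '' fccStacking 1 (Real.sqrt (2 / 3))) ∨
       (∃ G ∈ chainFrames z₂ (upFrame F₂ (-e₃)) v₂,
          G '' fccStacking 1 (Real.sqrt (2 / 3)) = F₁ '' fccStacking 1 (Real.sqrt (2 / 3)) ∨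
          G '' fccStacking 1 (Real.sqrt (2 / 3)) = (twinFrame F₁ (F₁ e₃)) '' fccStacking 1 (Real.sqrt (2 / 3))))

/-! ## The cover lemma -/

/-- **THE THREE CLASSES COVER THE UNCERTIFIED PAIRS**: a pair certified in none of the four presentation pairs is a flux-pair failure, or sep, or read.
Proof: if it is not a flux-pair failure, some presentation pair has a flux-feasible admissible launch pair; were its chain frames neither reading nor coaxial,
`twoSidedSteerWide_of_launches` would certify the pair in that presentation. -/
theorem threeClasses_of_not_repCertified {c₀ : ℝ} {σ₁ σ₂ : ℤ → ℤ} {L₁ L₂ : E3 ≃ₗᵢ[ℝ] E3}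
    (h : ¬ BarlowMenuSteer2WideRepCertified c₀ σ₁ σ₂ L₁ L₂) :
    FluxPairFailAt c₀ σ₁ σ₂ L₁ L₂ ∨ SepAt c₀ σ₁ σ₂ L₁ L₂ ∨ ReadAt c₀ σ₁ σ₂ L₁ L₂ := by
  by_cases hF : FluxPairFailAt c₀ σ₁ σ₂ L₁ L₂
  · exact Or.inl hF
  · right
    simp only [FluxPairFailAt, not_forall, not_exists, not_lt, exists_prop] at hF
    obtain ⟨τ₁, τ₂, F₁, F₂, hr₁, hr₂, z₁, v₁, z₂, v₂, hl₁, hl₂, hflux⟩ := hF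
    have hnc : ¬ BarlowMenuSteer2WideCertified c₀ τ₁ τ₂ F₁ F₂ := not_certified_of_isRep h hr₁ hr₂
    by_cases hco : ∃ G₁ ∈ chainFrames z₁ (upFrame F₁ e₃) v₁, ∃ G₂ ∈ chainFrames z₂ (upFrame F₂ (-e₃)) v₂, CoAxFrames G₁ G₂
    · exact Or.inl ⟨τ₁, τ₂, F₁, F₂, hr₁, hr₂, z₁, v₁, z₂, v₂, hl₁, hl₂, hflux, hco⟩
    by_cases hrd :
        (∃ G ∈ chainFrames z₁ (upFrame F₁ e₃) v₁,
            G '' fccStacking 1 (Real.sqrt (2 / 3)) = F₂ '' fccStacking 1 (Real.sqrt (2 / 3)) ∨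
            G '' fccStacking 1 (Real.sqrt (2 / 3)) = (twinFrame F₂ (F₂ e₃)) '' fccStacking 1 (Real.sqrt (2 / 3))) ∨
        (∃ G ∈ chainFrames z₂ (upFrame F₂ (-e₃)) v₂,
            G '' fccStacking 1 (Real.sqrt (2 / 3)) = F₁ '' fccStacking 1 (Real.sqrt (2 / 3)) ∨
            G '' fccStacking 1 (Real.sqrt (2 / 3)) = (twinFrame F₁ (F₁ e₃)) '' fccStacking 1 (Real.sqrt (2 / 3)))
    · exact Or.inr ⟨τ₁, τ₂, F₁, F₂, hr₁, hr₂, z₁, v₁, z₂, v₂, hl₁, hl₂, hflux, hrd⟩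
    -- otherwise all pair clauses hold and the pair would be certified in this presentation
    refine absurd (Or.inr ⟨z₁, v₁, z₂, v₂, twoSidedSteerWide_of_launches hl₁ hl₂ hflux ?_ ?_ ?_⟩) hnc
    · exact fun G hG => ⟨fun hG' => hrd (Or.inl ⟨G, hG, Or.inl hG'⟩), fun hG' => hrd (Or.inl ⟨G, hG, Or.inr hG'⟩)⟩
    · exact fun G hG => ⟨fun hG' => hrd (Or.inr ⟨G, hG, Or.inl hG'⟩), fun hG' => hrd (Or.inr ⟨G, hG, Or.inr hG'⟩)⟩
    · exact fun G₁ hG₁ G₂ hG₂ hc => hco ⟨G₁, hG₁, G₂, hG₂, hc⟩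

/-- **`edgeOnRep_cover`** (cf-p1 (clxxvii)(2), the requested shape): `EdgeOnAt c₀ → ¬ BarlowMenuSteer2WideRepCertified c₀ → FluxPairFailAt c₀ ∨ SepAt c₀ ∨ ReadAt c₀`. -/
theorem edgeOnRep_cover {c₀ : ℝ} {σ₁ σ₂ : ℤ → ℤ} {L₁ L₂ : E3 ≃ₗᵢ[ℝ] E3} (_hE : EdgeOnAt c₀ σ₁ σ₂ L₁ L₂)
    (h : ¬ BarlowMenuSteer2WideRepCertified c₀ σ₁ σ₂ L₁ L₂) :
    FluxPairFailAt c₀ σ₁ σ₂ L₁ L₂ ∨ SepAt c₀ σ₁ σ₂ L₁ L₂ ∨ ReadAt c₀ σ₁ σ₂ L₁ L₂ :=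
  threeClasses_of_not_repCertified h

/-- Conversely, sep and read pairs, and flux-pair failures, are NOT certified by the represented TWO-SIDED families in the exhibited presentation — recorded
for the flux class: a flux-pair failure has no represented two-sided certificate at all. -/
theorem not_twoSided_of_fluxPairFailAt {c₀ : ℝ} {σ₁ σ₂ τ₁ τ₂ : ℤ → ℤ} {L₁ L₂ F₁ F₂ : E3 ≃ₗᵢ[ℝ] E3}
    (h : FluxPairFailAt c₀ σ₁ σ₂ L₁ L₂) (h₁ : IsRep σ₁ L₁ τ₁ F₁) (h₂ : IsRep σ₂ L₂ τ₂ F₂) (z₁ v₁ z₂ v₂ : E3) :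
    ¬ BarlowTwoSidedCertifiedSteerWide c₀ τ₁ τ₂ F₁ F₂ z₁ v₁ z₂ v₂ := by
  intro hc
  obtain ⟨hl₁, hl₂⟩ := steerLaunchAt_of_twoSided hc
  obtain ⟨i, j, hlt⟩ := h τ₁ τ₂ F₁ F₂ h₁ h₂ z₁ v₁ z₂ v₂ hl₁ hl₂
  exact absurd (hc.2.2.2.2.2.2.2.2.2.2.2.2.1 i j) (not_le.2 hlt)

/-! ## The flux-pair class is never vacuous and forces both plates weak -/

/-- **A flux-pair failure has a witness**: some presentation pair and admissible launch pair with a bilayer pair of rise sum `< √2·c₀`. -/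
theorem exists_launches_of_fluxPairFailAt {c₀ : ℝ} {σ₁ σ₂ : ℤ → ℤ} {L₁ L₂ : E3 ≃ₗᵢ[ℝ] E3} (h : FluxPairFailAt c₀ σ₁ σ₂ L₁ L₂) :
    ∃ (τ₁ τ₂ : ℤ → ℤ) (F₁ F₂ : E3 ≃ₗᵢ[ℝ] E3), IsRep σ₁ L₁ τ₁ F₁ ∧ IsRep σ₂ L₂ τ₂ F₂ ∧
      ∃ z₁ v₁ z₂ v₂ : E3, SteerLaunchAt (1 / 3) F₁ τ₁ e₃ z₁ v₁ ∧ SteerLaunchAt (1 / 3) F₂ τ₂ (-e₃) z₂ v₂ ∧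
        ∃ i j : ℤ, steerRise (upFrame F₁ e₃) (upWord F₁ τ₁ e₃) e₃ z₁ v₁ i +
          steerRise (upFrame F₂ (-e₃)) (upWord F₂ τ₂ (-e₃)) (-e₃) z₂ v₂ j < Real.sqrt 2 * c₀ := by
  obtain ⟨τ₁, τ₂, F₁, F₂, hr₁, hr₂, z₁, v₁, z₂, v₂, hl₁, hl₂⟩ := exists_isRep_launches σ₁ σ₂ L₁ L₂
  exact ⟨τ₁, τ₂, F₁, F₂, hr₁, hr₂, z₁, v₁, z₂, v₂, hl₁, hl₂, h τ₁ τ₂ F₁ F₂ hr₁ hr₂ z₁ v₁ z₂ v₂ hl₁ hl₂⟩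

/-- **Every steered step of an admissible launch rises by `≥ 1/4`** toward the unit axis `e` (chord `1/3`, Hägg word): the launch slot rises by
`≥ steerSteepCos (1/3) ≥ 1/4` (`inner_ge_steerSteepCos_of_steep_of_near`), the ∇-capper by `≥ 1/4` (launch clause). -/
theorem quarter_le_steerRise_of_steerLaunchAt {F : E3 ≃ₗᵢ[ℝ] E3} {τ : ℤ → ℤ} (hτ : IsHaggSeq τ) {e z v : E3} (he : ‖e‖ = 1)
    (h : SteerLaunchAt (1 / 3) F τ e z v) (i : ℤ) : (1 / 4 : ℝ) ≤ steerRise (upFrame F e) (upWord F τ e) e z v i := by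
  obtain ⟨hz, hnear, hv, _, hsteep, hcap⟩ := h
  rcases isHaggSeq_upWord F hτ e i with hi | hi
  · rw [steerRise_of_eq_one _ _ _ _ hi]
    have ha : ‖upFrame F e v‖ = 1 := by rw [LinearIsometryEquiv.norm_map, norm_eq_one_of_mem_fccSlots hv]
    exact steerSteepCos_third_ge_quarter.trans
      (inner_ge_steerSteepCos_of_steep_of_near ha hz he (by norm_num) (by norm_num) hsteep hnear)
  · rw [steerRise_of_eq_neg_one _ _ _ _ hi]
    exact hcap i hi

/-- **WEAK PLATE at threshold `t`** toward `e`: in every presentation, every admissible launch at chord `1/3` has a bilayer whose steered step rises by `< t`. -/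
def WeakPlateAt (t : ℝ) (σ : ℤ → ℤ) (L : E3 ≃ₗᵢ[ℝ] E3) (e : E3) : Prop :=
  ∀ (τ : ℤ → ℤ) (F : E3 ≃ₗᵢ[ℝ] E3), IsRep σ L τ F → ∀ z v : E3, SteerLaunchAt (1 / 3) F τ e z v →
    ∃ i : ℤ, steerRise (upFrame F e) (upWord F τ e) e z v i < t

/-- **A flux-pair failure forces BOTH plates weak at threshold `√2·c₀ − 1/4`** (Hägg words): the other plate launches (`exists_isRep_launches` geometry) and each
of its steps rises by `≥ 1/4`, so the failing bilayer pair has this plate's rise `< √2·c₀ − 1/4` (`= 0.4854…` at `c₀ = 13/25`: the memo's «both plates weak»,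
with the typed capper floor `1/4` in place of `1/(2√3)`). -/
theorem weakPlateAt_of_fluxPairFailAt {c₀ : ℝ} {σ₁ σ₂ : ℤ → ℤ} (hσ₁ : IsHaggSeq σ₁) (hσ₂ : IsHaggSeq σ₂) {L₁ L₂ : E3 ≃ₗᵢ[ℝ] E3}
    (h : FluxPairFailAt c₀ σ₁ σ₂ L₁ L₂) :
    WeakPlateAt (Real.sqrt 2 * c₀ - 1 / 4) σ₁ L₁ e₃ ∧ WeakPlateAt (Real.sqrt 2 * c₀ - 1 / 4) σ₂ L₂ (-e₃) := by
  obtain ⟨τ₁', τ₂', F₁', F₂', hr₁', hr₂', z₁', v₁', z₂', v₂', hl₁', hl₂'⟩ := exists_isRep_launches σ₁ σ₂ L₁ L₂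
  have hne : ‖(-e₃ : E3)‖ = 1 := by rw [norm_neg, norm_e₃_eq_one]
  constructor
  · intro τ₁ F₁ hr₁ z₁ v₁ hl₁
    obtain ⟨i, j, hlt⟩ := h τ₁ τ₂' F₁ F₂' hr₁ hr₂' z₁ v₁ z₂' v₂' hl₁ hl₂'
    have hq := quarter_le_steerRise_of_steerLaunchAt (isHaggSeq_of_isRep hr₂' hσ₂) hne hl₂' j
    exact ⟨i, by linarith⟩
  · intro τ₂ F₂ hr₂ z₂ v₂ hl₂
    obtain ⟨i, j, hlt⟩ := h τ₁' τ₂ F₁' F₂ hr₁' hr₂ z₁' v₁' z₂ v₂ hl₁' hl₂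
    have hq := quarter_le_steerRise_of_steerLaunchAt (isHaggSeq_of_isRep hr₁' hσ₁) norm_e₃_eq_one hl₁' i
    exact ⟨j, by linarith⟩

/-! ## The cut glue: three cores ⇒ the represented edge-on core -/

/-- **Three cores give the represented edge-on core, general `(c₀, R₀)`** (`R₀ ≥ 0`): cores on `EdgeOnAt c₀ ∧ FluxPairFailAt c₀` (`C₁`), `EdgeOnAt ∧ SepAt`
(`C₂`), `EdgeOnAt ∧ ReadAt` (`C₃`) give the core on `EdgeOnAt c₀ ∧ ¬ BarlowMenuSteer2WideRepCertified c₀` at `max (max C₁ C₂) C₃` (`threeClasses_of_not_repCertified`). -/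
theorem residualFaultedCoreOnAt_edgeOnRep_of_threeClasses {c₀ C₁ C₂ C₃ R₀ : ℝ} (hR₀ : 0 ≤ R₀)
    (h₁ : BilayerWallResidualFaultedCoreOnAt (fun σ₁ σ₂ L₁ L₂ => EdgeOnAt c₀ σ₁ σ₂ L₁ L₂ ∧ FluxPairFailAt c₀ σ₁ σ₂ L₁ L₂) c₀ C₁ R₀)
    (h₂ : BilayerWallResidualFaultedCoreOnAt (fun σ₁ σ₂ L₁ L₂ => EdgeOnAt c₀ σ₁ σ₂ L₁ L₂ ∧ SepAt c₀ σ₁ σ₂ L₁ L₂) c₀ C₂ R₀)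
    (h₃ : BilayerWallResidualFaultedCoreOnAt (fun σ₁ σ₂ L₁ L₂ => EdgeOnAt c₀ σ₁ σ₂ L₁ L₂ ∧ ReadAt c₀ σ₁ σ₂ L₁ L₂) c₀ C₃ R₀) :
    BilayerWallResidualFaultedCoreOnAt
      (fun σ₁ σ₂ L₁ L₂ => EdgeOnAt c₀ σ₁ σ₂ L₁ L₂ ∧ ¬ BarlowMenuSteer2WideRepCertified c₀ σ₁ σ₂ L₁ L₂) c₀ (max (max C₁ C₂) C₃) R₀ :=
  residualFaultedCoreOnAt_anti
    (Rem := fun σ₁ σ₂ L₁ L₂ =>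
      ((EdgeOnAt c₀ σ₁ σ₂ L₁ L₂ ∧ FluxPairFailAt c₀ σ₁ σ₂ L₁ L₂) ∨ (EdgeOnAt c₀ σ₁ σ₂ L₁ L₂ ∧ SepAt c₀ σ₁ σ₂ L₁ L₂)) ∨
        (EdgeOnAt c₀ σ₁ σ₂ L₁ L₂ ∧ ReadAt c₀ σ₁ σ₂ L₁ L₂))
    (fun σ₁ σ₂ L₁ L₂ hx => by
      rcases threeClasses_of_not_repCertified hx.2 with hc | hc | hc
      · exact Or.inl (Or.inl ⟨hx.1, hc⟩)
      · exact Or.inl (Or.inr ⟨hx.1, hc⟩)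
      · exact Or.inr ⟨hx.1, hc⟩)
    (residualFaultedCoreOnAt_union hR₀ (residualFaultedCoreOnAt_union hR₀ h₁ h₂) h₃)

/-- **`edgeOnRep_of_threeClasses` — the v8.10 cut at `(13/25, 10)`** (cf-p1 (clxxvii)(2)): `(∃ C, core on EdgeOn ∧ FluxPairFail) → (∃ C, core on EdgeOn ∧ Sep) →
(∃ C, core on EdgeOn ∧ Read) → ∃ C, core on EdgeOn ∧ ¬RepMenu` (= v8.9's `stub_edgeOnRep`). -/
theorem edgeOnRep_of_threeClasses
    (hflux : ∃ C : ℝ, BilayerWallResidualFaultedCoreOnAt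
      (fun σ₁ σ₂ L₁ L₂ => EdgeOnAt (13 / 25) σ₁ σ₂ L₁ L₂ ∧ FluxPairFailAt (13 / 25) σ₁ σ₂ L₁ L₂) (13 / 25) C 10)
    (hsep : ∃ C : ℝ, BilayerWallResidualFaultedCoreOnAt
      (fun σ₁ σ₂ L₁ L₂ => EdgeOnAt (13 / 25) σ₁ σ₂ L₁ L₂ ∧ SepAt (13 / 25) σ₁ σ₂ L₁ L₂) (13 / 25) C 10)
    (hread : ∃ C : ℝ, BilayerWallResidualFaultedCoreOnAt
      (fun σ₁ σ₂ L₁ L₂ => EdgeOnAt (13 / 25) σ₁ σ₂ L₁ L₂ ∧ ReadAt (13 / 25) σ₁ σ₂ L₁ L₂) (13 / 25) C 10) :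
    ∃ C : ℝ, BilayerWallResidualFaultedCoreOnAt
      (fun σ₁ σ₂ L₁ L₂ => EdgeOnAt (13 / 25) σ₁ σ₂ L₁ L₂ ∧ ¬ BarlowMenuSteer2WideRepCertified (13 / 25) σ₁ σ₂ L₁ L₂) (13 / 25) C 10 := by
  obtain ⟨C₁, h₁⟩ := hflux
  obtain ⟨C₂, h₂⟩ := hsep
  obtain ⟨C₃, h₃⟩ := hread
  exact ⟨_, residualFaultedCoreOnAt_edgeOnRep_of_threeClasses (by norm_num) h₁ h₂ h₃⟩

/-- **Monotonicity, v8.9 → v8.10**: the represented edge-on core restricts to each of the three classes (so the split loses nothing). -/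
theorem residualFaultedCoreOnAt_threeClasses_of_edgeOnRep {c₀ C R₀ : ℝ}
    (h : BilayerWallResidualFaultedCoreOnAt
      (fun σ₁ σ₂ L₁ L₂ => EdgeOnAt c₀ σ₁ σ₂ L₁ L₂ ∧ ¬ BarlowMenuSteer2WideRepCertified c₀ σ₁ σ₂ L₁ L₂) c₀ C R₀)
    {X : (ℤ → ℤ) → (ℤ → ℤ) → (E3 ≃ₗᵢ[ℝ] E3) → (E3 ≃ₗᵢ[ℝ] E3) → Prop}
    (hX : ∀ σ₁ σ₂ L₁ L₂, X σ₁ σ₂ L₁ L₂ → ¬ BarlowMenuSteer2WideRepCertified c₀ σ₁ σ₂ L₁ L₂) :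
    BilayerWallResidualFaultedCoreOnAt (fun σ₁ σ₂ L₁ L₂ => EdgeOnAt c₀ σ₁ σ₂ L₁ L₂ ∧ X σ₁ σ₂ L₁ L₂) c₀ C R₀ :=
  residualFaultedCoreOnAt_anti (fun σ₁ σ₂ L₁ L₂ hx => ⟨hx.1, hX σ₁ σ₂ L₁ L₂ hx.2⟩) h

end Summit.Ventures.Crystal3D.Cruxes.TextureLiminf.TexShadow

end
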